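import Mathlib
import HarnessLib
import Literature.AlgebraicGeometry.Ramification.InertiaNormalSylow

/-!
# `p`-closed ⇔ the `p`-elements generate a `p`-group (crux `WildQuotients.WildQuotientResolution`, line `Sketch`)

Stub `stub_hasNormalSylow_iff` of the skeleton `Sketch` for crux stmt-ResolutionOfSingularities-15640
(route `ResolutionOfSingularities/WildQuotients`, card `p-closure-sylow-separation`): the dictionary
between Abbes–Saito's property (NpS) of an inertia group `I` — `I` is *`p`-closed*, i.e. has a normal
Sylow `p`-subgroup, the tree's `Literature.AlgebraicGeometry.Ramification.HasNormalSylow p I` — and the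
subgroup `Π(I) = ⟨g : g ^ p ^ n = 1⟩` generated by the elements of `p`-power order, which Phase 0
("Sylow separation") of the wild-quotient resolution tracks along equivariant blow-ups:
a finite group `I` is `p`-closed iff `Π(I)` is a `p`-group.

Proof.
* `normal_closure_pElements`: `Π(I)` is normal (conjugation permutes the `p`-elements;
  `Subgroup.closure_induction`);
* `sylow_le_closure_pElements`: every Sylow `p`-subgroup consists of `p`-elements, so lies in `Π(I)`;
* (⇒) `closure_pElements_le_of_normal`: if the Sylow `p`-subgroup `P` is normal it is unique
  (`Sylow.unique_of_normal`), every `p`-element generates a `p`-subgroup (`isPGroup_zpowers`) contained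
  in some Sylow (`IsPGroup.exists_le_sylow`), i.e. in `P`; so `Π(I) ≤ P` is a `p`-group (`IsPGroup.to_le`);
* (⇐) `hasNormalSylow_of_isPGroup_closure`: if `Π(I)` is a `p`-group, a Sylow `p`-subgroup `P ⊇ Π(I)`
  (`IsPGroup.exists_le_sylow`) equals `Π(I)`, hence is normal (no finiteness needed).
-/

-- single-problem summit: the doubled namespace component `ResolutionOfSingularities` is forced
set_option linter.dupNamespace false

namespace Summit.ResolutionOfSingularities.ResolutionOfSingularities.Theorems.WildQuotientResolution.NormalSylow

open Literature.AlgebraicGeometry.Ramification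

variable {p : ℕ} {G : Type*} [Group G]

/-! ## The subgroup generated by the `p`-elements -/

/-- The set of `p`-elements (`g ^ p ^ n = 1` for some `n`) is stable under conjugation. [folklore] -/
theorem conj_mem_pElements {x : G} (hx : x ∈ {g : G | ∃ n : ℕ, g ^ p ^ n = 1}) (g : G) :
    g * x * g⁻¹ ∈ {g : G | ∃ n : ℕ, g ^ p ^ n = 1} := by
  obtain ⟨n, hn⟩ := hx
  exact ⟨n, by rw [conj_pow, hn, mul_one, mul_inv_cancel]⟩

/-- The subgroup `Π(G)` generated by the `p`-elements of `G` is normal (indeed characteristic).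
[folklore] -/
theorem normal_closure_pElements :
    (Subgroup.closure {g : G | ∃ n : ℕ, g ^ p ^ n = 1}).Normal := by
  refine ⟨fun x hx g => ?_⟩
  refine Subgroup.closure_induction
    (p := fun x _ => g * x * g⁻¹ ∈ Subgroup.closure {g : G | ∃ n : ℕ, g ^ p ^ n = 1})
    (fun x hx => Subgroup.subset_closure (conj_mem_pElements hx g)) (by simp)
    (fun x y _ _ hx hy => ?_) (fun x _ hx => ?_) hx
  · have : g * (x * y) * g⁻¹ = (g * x * g⁻¹) * (g * y * g⁻¹) := by group
    rw [this]
    exact Subgroup.mul_mem _ hx hy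
  · have : g * x⁻¹ * g⁻¹ = (g * x * g⁻¹)⁻¹ := by group
    rw [this]
    exact Subgroup.inv_mem _ hx

/-- Every `p`-subgroup — in particular every Sylow `p`-subgroup — consists of `p`-elements, so lies
in `Π(G)`. [folklore] -/
theorem le_closure_pElements_of_isPGroup {H : Subgroup G} (hH : IsPGroup p H) :
    H ≤ Subgroup.closure {g : G | ∃ n : ℕ, g ^ p ^ n = 1} := by
  intro g hg
  apply Subgroup.subset_closure
  obtain ⟨k, hk⟩ := hH ⟨g, hg⟩
  exact ⟨k, by simpa using congrArg Subtype.val hk⟩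

/-- A Sylow `p`-subgroup lies in `Π(G)`. [folklore] -/
theorem sylow_le_closure_pElements (P : Sylow p G) :
    (P : Subgroup G) ≤ Subgroup.closure {g : G | ∃ n : ℕ, g ^ p ^ n = 1} :=
  le_closure_pElements_of_isPGroup P.isPGroup'

/-- A `p`-element generates a `p`-subgroup. [folklore] -/
theorem isPGroup_zpowers {g : G} {n : ℕ} (hg : g ^ p ^ n = 1) :
    IsPGroup p (Subgroup.zpowers g) := by
  rintro ⟨x, hx⟩
  obtain ⟨k, rfl⟩ := Subgroup.mem_zpowers_iff.mp hx
  refine ⟨n, Subtype.ext ?_⟩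
  simp only [SubgroupClass.coe_pow, OneMemClass.coe_one]
  rw [← zpow_natCast, ← zpow_mul, mul_comm, zpow_mul, zpow_natCast, hg, one_zpow]

/-! ## (⇒): a normal Sylow `p`-subgroup contains every `p`-element -/

/-- If the Sylow `p`-subgroup `P` is normal (hence unique), then `Π(G) ≤ P`: every `p`-element
generates a `p`-subgroup, contained in some Sylow `p`-subgroup, which is `P`. [folklore] -/
theorem closure_pElements_le_of_normal [Fact p.Prime] [Finite (Sylow p G)] (P : Sylow p G)
    (hP : (P : Subgroup G).Normal) :
    Subgroup.closure {g : G | ∃ n : ℕ, g ^ p ^ n = 1} ≤ P := by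
  rw [Subgroup.closure_le]
  rintro g ⟨n, hn⟩
  obtain ⟨Q, hQ⟩ := (isPGroup_zpowers hn).exists_le_sylow
  haveI := Sylow.unique_of_normal P hP
  rw [Subsingleton.elim P Q]
  exact hQ (Subgroup.mem_zpowers g)

/-- If the Sylow `p`-subgroup `P` is normal then `Π(G) = P`. [folklore] -/
theorem closure_pElements_eq_of_normal [Fact p.Prime] [Finite (Sylow p G)] (P : Sylow p G)
    (hP : (P : Subgroup G).Normal) :
    Subgroup.closure {g : G | ∃ n : ℕ, g ^ p ^ n = 1} = P :=
  le_antisymm (closure_pElements_le_of_normal P hP) (sylow_le_closure_pElements P)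

/-- (⇒) A `p`-closed group (with finitely many Sylow `p`-subgroups, e.g. finite) has `Π(G)` a
`p`-group. [folklore] -/
theorem isPGroup_closure_of_hasNormalSylow [Fact p.Prime] [Finite (Sylow p G)]
    (h : HasNormalSylow p G) :
    IsPGroup p (Subgroup.closure {g : G | ∃ n : ℕ, g ^ p ^ n = 1}) := by
  obtain ⟨P, hP⟩ := h
  exact P.isPGroup'.to_le (closure_pElements_le_of_normal P hP)

/-! ## (⇐): if `Π(G)` is a `p`-group it is the (normal) Sylow `p`-subgroup -/

/-- (⇐) If `Π(G)` is a `p`-group then `G` is `p`-closed: a Sylow `p`-subgroup containing `Π(G)`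
consists of `p`-elements, so equals the normal subgroup `Π(G)`. [folklore] -/
theorem hasNormalSylow_of_isPGroup_closure
    (h : IsPGroup p (Subgroup.closure {g : G | ∃ n : ℕ, g ^ p ^ n = 1})) :
    HasNormalSylow p G := by
  obtain ⟨P, hP⟩ := h.exists_le_sylow
  have heq : (P : Subgroup G) = Subgroup.closure {g : G | ∃ n : ℕ, g ^ p ^ n = 1} :=
    le_antisymm (sylow_le_closure_pElements P) hP
  exact ⟨P, heq ▸ normal_closure_pElements⟩

/-! ## The stub -/

/-- **`p`-closed ⇔ the `p`-elements generate a `p`-group**: a finite group `I` has a normal Sylow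
`p`-subgroup iff the subgroup generated by its elements of `p`-power order is a `p`-group
(⇒: every `p`-element lies in the unique Sylow; ⇐: that subgroup is normal, and a Sylow
`p`-subgroup containing it consists of `p`-elements, hence equals it). [folklore] -/
theorem stub_hasNormalSylow_iff (p : ℕ) [Fact p.Prime] {I : Type} [Group I] [Finite I] :
    HasNormalSylow p I ↔ IsPGroup p (Subgroup.closure {g : I | ∃ n : ℕ, g ^ p ^ n = 1}) :=
  ⟨isPGroup_closure_of_hasNormalSylow, hasNormalSylow_of_isPGroup_closure⟩

end Summit.ResolutionOfSingularities.ResolutionOfSingularities.Theorems.WildQuotientResolution.NormalSylow
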